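import Mathlib.FieldTheory.Finite.Basic
import Mathlib.Algebra.CharP.Lemmas
import Mathlib.LinearAlgebra.Matrix.Charpoly.Coeff
import Mathlib.LinearAlgebra.Matrix.GeneralLinearGroup.Defs
import Literature.RepresentationTheory.Semisimple.FinTwoSemisimplification
import HarnessLib

/-!
# Descent of two-dimensional representations to a finite field of definition of the
# characteristic polynomials: the reducible case

Towards Deligne–Serre 1974, Lemme 6.13 ("Soit `φ : Φ → GL_n(k')` une représentation
semi-simple d'un groupe `Φ` sur un corps fini `k'`. Soit `k` un sous-corps de `k'` contenant les
coefficients des polynômes `det(1 - φ(s)T)`, `s ∈ Φ`. Alors `φ` est réalisable sur `k`") for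
`n = 2`, in the form needed for op. cit. Thm. 6.7: given `φ : G → GL₂(L)` over a field `L`
containing the finite field `k` (via `j : k → L`), all of whose characteristic polynomials lie in
`k[X]`, we look for `ρ : G → GL₂(k)` with the **same characteristic polynomials**
(`det(X - ρ(g)) ↦ det(X - φ(g))`) and `ker φ ≤ ker ρ`. This file PROVES it when the `φ(g)` have
a **common eigenvector** (the case where `φ` is reducible over `L`; for `L` algebraically closed
this is the case "`φ` not absolutely irreducible"). Everything is elementary: with `χ₁` the
eigencharacter and `χ₂ = det/χ₁`, the Frobenius `x ↦ x^q` (`q = #k`) permutes `{χ₁(g), χ₂(g)}`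
for each `g`; a group is not the union of two proper subgroups, so either all `χᵢ(g)` lie in
`k` (and `ρ = diag(χ₁, χ₂)`), or `χ₂ = χ₁^q` and `χ₁` takes values in the quadratic extension
`k₂ = {x | x^{q²} = x}` of `k` inside `L`, and `ρ(g)` is the matrix of multiplication by `χ₁(g)`
on `k₂ = k ⊕ k α` (explicit `2 × 2` matrices `(u, wt; w, u + ws)` for `x = u + w α`,
`α² = s α + t`).

* `Literature.RepresentationTheory.Semisimple.exists_descent_fin_two_of_common_eigenvector`.

## References

* P. Deligne, J.-P. Serre, *Formes modulaires de poids 1*, Ann. Sci. ÉNS (4) 7 (1974),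
  Lemme 6.13.
-/

noncomputable section

open scoped MatrixGroups

open Matrix Polynomial Module

namespace Literature.RepresentationTheory.Semisimple

universe u v w

/-! ### A group is not the union of two proper subgroups -/

/-- A group is not the union of two proper subgroups. [folklore] -/
theorem subgroup_eq_top_or_eq_top_of_union {G : Type*} [Group G] (A B : Subgroup G)
    (h : ∀ g : G, g ∈ A ∨ g ∈ B) : A = ⊤ ∨ B = ⊤ := by
  by_contra hcon
  rw [not_or] at hcon
  obtain ⟨hA, hB⟩ := hcon
  obtain ⟨a, haB⟩ : ∃ a, a ∉ B := by
    by_contra h'; push Not at h'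
    exact hB (eq_top_iff.mpr fun g _ ↦ h' g)
  obtain ⟨b, hbA⟩ : ∃ b, b ∉ A := by
    by_contra h'; push Not at h'
    exact hA (eq_top_iff.mpr fun g _ ↦ h' g)
  have haA : a ∈ A := (h a).resolve_right haB
  have hbB : b ∈ B := (h b).resolve_left hbA
  rcases h (a * b) with hab | hab
  · exact hbA (by simpa using A.mul_mem (A.inv_mem haA) hab)
  · exact haB (by simpa using B.mul_mem hab (B.inv_mem hbB))

/-! ### The image of a finite field inside a field -/

section FiniteSubfield

variable {k : Type u} [Field k] [Fintype k] {L : Type v} [Field L] (j : k →+* L)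

/-- The image of a finite field `k` with `q` elements in a field `L` is the set of roots of
`X^q - X`: `y = j x` for some `x` iff `y ^ q = y`. [folklore] -/
theorem mem_range_iff_pow_card_eq (y : L) : y ∈ Set.range j ↔ y ^ Fintype.card k = y := by
  classical
  set q := Fintype.card k with hq
  constructor
  · rintro ⟨x, rfl⟩
    rw [← map_pow, FiniteField.pow_card]
  · intro hy
    -- the `q` distinct elements `j x` are roots of `X^q - X`, which has at most `q` roots
    have hq1 : 1 < q := Fintype.one_lt_card
    set P : L[X] := X ^ q - X with hP
    have hP0 : P ≠ 0 := FiniteField.X_pow_card_sub_X_ne_zero L hq1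
    have hroots : ∀ z : L, z ∈ P.roots ↔ z ^ q = z := fun z ↦ by
      rw [Polynomial.mem_roots hP0, Polynomial.IsRoot, hP, eval_sub, eval_pow, eval_X, sub_eq_zero]
    have hcard : P.roots.toFinset.card ≤ q := by
      calc P.roots.toFinset.card ≤ Multiset.card P.roots := Multiset.toFinset_card_le _
        _ ≤ P.natDegree := Polynomial.card_roots' P
        _ = q := FiniteField.X_pow_card_sub_X_natDegree_eq L hq1
    have himage : (Finset.univ.image j) ⊆ P.roots.toFinset := by
      intro z hz
      obtain ⟨x, -, rfl⟩ := Finset.mem_image.mp hz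
      rw [Multiset.mem_toFinset, hroots, ← map_pow, FiniteField.pow_card]
    have hcardim : (Finset.univ.image j).card = q := by
      rw [Finset.card_image_of_injective _ j.injective, Finset.card_univ]
    have heq : Finset.univ.image j = P.roots.toFinset :=
      Finset.eq_of_subset_of_card_le himage (by rw [hcardim]; exact hcard)
    have hy' : y ∈ P.roots.toFinset := by rw [Multiset.mem_toFinset, hroots]; exact hy
    rw [← heq] at hy'
    obtain ⟨x, -, rfl⟩ := Finset.mem_image.mp hy'
    exact ⟨x, rfl⟩

end FiniteSubfield

/-! ### Arithmetic in the quadratic extension `{x | x^{q²} = x}` of `{x | x^q = x}` -/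

section Quadratic

variable {L : Type v} [Field L] {q : ℕ}

/-- `(x - y)^q = x^q - y^q` from additivity of `x ↦ x^q`. [folklore] -/
theorem sub_pow_eq_of_add_pow_eq (hF : ∀ x y : L, (x + y) ^ q = x ^ q + y ^ q) (x y : L) :
    (x - y) ^ q = x ^ q - y ^ q := by
  have := hF (x - y) y
  rw [sub_add_cancel] at this
  rw [this, add_sub_cancel_right]

/-- Coordinates in the quadratic extension: for `α` with `α^{q²} = α ≠ α^q` and `x` with
`x^{q²} = x`, put `w = (x - x^q)/(α - α^q)` and `u = x - w α`; then `u, w` are fixed by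
`y ↦ y^q`, `x = u + w α` and `x^q = u + w α^q`. [folklore] -/
theorem quadratic_coords (hF : ∀ x y : L, (x + y) ^ q = x ^ q + y ^ q) {α : L}
    (hα : (α ^ q) ^ q = α) (hα' : α ^ q ≠ α) {x : L} (hx : (x ^ q) ^ q = x) :
    ((x - x ^ q) / (α - α ^ q)) ^ q = (x - x ^ q) / (α - α ^ q) ∧
      (x - (x - x ^ q) / (α - α ^ q) * α) ^ q = x - (x - x ^ q) / (α - α ^ q) * α ∧
      x ^ q = (x - (x - x ^ q) / (α - α ^ q) * α) + (x - x ^ q) / (α - α ^ q) * α ^ q := by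
  have hd : α - α ^ q ≠ 0 := sub_ne_zero.mpr (Ne.symm hα')
  have hsub := sub_pow_eq_of_add_pow_eq hF
  set w := (x - x ^ q) / (α - α ^ q) with hw
  have hwq : w ^ q = w := by
    rw [hw, div_pow, hsub, hsub, hx, hα, ← neg_sub x (x ^ q), ← neg_sub α (α ^ q), neg_div_neg_eq]
  have hxq : x ^ q = (x - w * α) + w * α ^ q := by
    have : w * (α - α ^ q) = x - x ^ q := by rw [hw, div_mul_cancel₀ _ hd]
    linear_combination this
  refine ⟨hwq, ?_, hxq⟩
  rw [hsub, mul_pow, hwq]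
  linear_combination hxq

/-- Uniqueness of coordinates: `a + b α = a' + b' α` with `a, b, a', b'` fixed by `y ↦ y^q` and
`α^q ≠ α` forces `a = a'`, `b = b'`. [folklore] -/
theorem quadratic_coords_unique (hF : ∀ x y : L, (x + y) ^ q = x ^ q + y ^ q) {α : L}
    (hα' : α ^ q ≠ α) {a b a' b' : L} (ha : a ^ q = a) (hb : b ^ q = b) (ha' : a' ^ q = a')
    (hb' : b' ^ q = b') (h : a + b * α = a' + b' * α) : a = a' ∧ b = b' := by
  have hsub := sub_pow_eq_of_add_pow_eq hF
  by_cases hbb : b = b'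
  · subst hbb
    exact ⟨by linear_combination h, rfl⟩
  · exfalso
    have hne : b - b' ≠ 0 := sub_ne_zero.mpr hbb
    have hαeq : α = (a' - a) / (b - b') := by
      rw [eq_div_iff hne]; linear_combination h
    apply hα'
    rw [hαeq, div_pow, hsub, hsub, ha, ha', hb, hb']

/-- The matrix of multiplication by `u + w α` on `k ⊕ k α`, `α² = s α + t`, in the basis
`(1, α)`: `(u, wt; w, u + ws)`. Multiplicativity. [folklore] -/
theorem mulMatrix_mul {R : Type*} [CommRing R] (s t u w u' w' : R) :
    !![u * u' + w * w' * t, (u * w' + w * u' + w * w' * s) * t;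
        u * w' + w * u' + w * w' * s, u * u' + w * w' * t + (u * w' + w * u' + w * w' * s) * s] =
      !![u, w * t; w, u + w * s] * !![u', w' * t; w', u' + w' * s] := by
  ext i j
  fin_cases i <;> fin_cases j <;>
    simp [Matrix.mul_apply, Fin.sum_univ_two] <;> ring

/-- Trace of the multiplication matrix `(u, wt; w, u + ws)`. [folklore] -/
theorem mulMatrix_trace {R : Type*} [CommRing R] (s t u w : R) :
    (!![u, w * t; w, u + w * s]).trace = 2 * u + w * s := by
  rw [Matrix.trace_fin_two_of]; ring

/-- Determinant of the multiplication matrix `(u, wt; w, u + ws)`. [folklore] -/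
theorem mulMatrix_det {R : Type*} [CommRing R] (s t u w : R) :
    (!![u, w * t; w, u + w * s]).det = u ^ 2 + u * w * s - w ^ 2 * t := by
  rw [Matrix.det_fin_two_of]; ring

end Quadratic

/-! ### Descent in the presence of a common eigenvector -/

section CommonEigenvector

variable {k : Type u} [Field k] [Fintype k] {L : Type v} [Field L] (j : k →+* L)
  {G : Type w} [Group G]

set_option maxHeartbeats 1600000 in
/-- **Descent to `k` of a two-dimensional representation with characteristic polynomials in
`k[X]` and a common eigenvector** (the reducible case of Deligne–Serre 1974, Lemme 6.13, `n = 2`,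
in characteristic-polynomial form): there is `ρ : G → GL₂(k)` with `ker φ ≤ ker ρ` and
`det(X - ρ(g)) ↦ det(X - φ(g))` under `j`. [cite: DeligneSerreASENS1974, Lemme 6.13] -/
theorem exists_descent_fin_two_of_common_eigenvector (φ : G →* GL (Fin 2) L)
    (hφ : ∀ g, ∃ Q : k[X], Q.map j = ((φ g : GL (Fin 2) L) : Matrix (Fin 2) (Fin 2) L).charpoly)
    {v : Fin 2 → L} (hv : v ≠ 0)
    (heig : ∀ g, ((φ g : GL (Fin 2) L) : Matrix (Fin 2) (Fin 2) L) *ᵥ v ∈ L ∙ v) :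
    ∃ ρ : G →* GL (Fin 2) k, φ.ker ≤ ρ.ker ∧
      ∀ g, (((ρ g : GL (Fin 2) k) : Matrix (Fin 2) (Fin 2) k).charpoly).map j =
        ((φ g : GL (Fin 2) L) : Matrix (Fin 2) (Fin 2) L).charpoly := by
  classical
  -- ### Frobenius `y ↦ y^q` on `L`
  set q := Fintype.card k with hqdef
  obtain ⟨p, hpchar⟩ := CharP.exists k
  haveI : CharP k p := hpchar
  have hp : p.Prime := CharP.char_is_prime k p
  haveI : Fact p.Prime := ⟨hp⟩
  haveI : CharP L p := (RingHom.charP_iff_charP j p).mp hpchar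
  obtain ⟨n, -, hqn⟩ := FiniteField.card k p
  have hF : ∀ x y : L, (x + y) ^ q = x ^ q + y ^ q := fun x y ↦ by
    rw [hqdef, hqn]; exact add_pow_char_pow x y p (n : ℕ)
  have hsub := sub_pow_eq_of_add_pow_eq hF
  have hfix : ∀ y : L, (∃ x, j x = y) ↔ y ^ q = y := fun y ↦ by
    rw [← Set.mem_range, mem_range_iff_pow_card_eq j y]
  have hneg : ∀ y : L, (-y) ^ q = -y ^ q := fun y ↦ by
    have := hsub 0 y
    rwa [zero_sub, zero_pow Fintype.card_ne_zero, zero_sub] at this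
  -- a section of `j` on the fixed elements
  let jinv : L → k := fun y ↦ if h : ∃ x, j x = y then h.choose else 0
  have hjinv : ∀ y : L, y ^ q = y → j (jinv y) = y := fun y hy ↦ by
    have h := (hfix y).mpr hy
    simp only [jinv, dif_pos h]
    exact h.choose_spec
  have hjinv_j : ∀ x : k, jinv (j x) = x := fun x ↦
    j.injective (hjinv _ ((hfix _).mp ⟨x, rfl⟩))
  -- ### the eigencharacter `χ` and `χ₂ = det / χ`
  set M : G → Matrix (Fin 2) (Fin 2) L := fun g ↦ ((φ g : GL (Fin 2) L) : Matrix (Fin 2) (Fin 2) L)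
    with hMdef
  have hMmul : ∀ g h, M (g * h) = M g * M h := fun g h ↦ by
    simp only [hMdef, map_mul, Units.val_mul]
  have hMone : M 1 = 1 := by simp only [hMdef, map_one, Units.val_one]
  have hex : ∀ g : G, ∃ c : L, c • v = M g *ᵥ v := fun g ↦ by
    obtain ⟨c, hc⟩ := Submodule.mem_span_singleton.mp (heig g)
    exact ⟨c, hc⟩
  choose χ hχ using hex
  have hχmul : ∀ g h, χ (g * h) = χ g * χ h := by
    intro g h
    apply smul_left_injective L hv
    change χ (g * h) • v = (χ g * χ h) • v
    rw [hχ, hMmul, ← Matrix.mulVec_mulVec, ← hχ h, Matrix.mulVec_smul, ← hχ g, smul_smul,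
      mul_comm]
  have hχone : χ 1 = 1 := by
    apply smul_left_injective L hv
    change χ 1 • v = (1 : L) • v
    rw [hχ, hMone, Matrix.one_mulVec, one_smul]
  have hχne : ∀ g, χ g ≠ 0 := by
    intro g hg
    have h1 := hχmul g⁻¹ g
    rw [inv_mul_cancel, hχone, hg, mul_zero] at h1
    exact one_ne_zero h1
  have hχinv : ∀ g, χ g⁻¹ = (χ g)⁻¹ := fun g ↦ by
    have h1 := hχmul g⁻¹ g
    rw [inv_mul_cancel, hχone] at h1
    exact eq_inv_of_mul_eq_one_left h1.symm
  set τ : G → L := fun g ↦ (M g).trace with hτdef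
  set δ : G → L := fun g ↦ (M g).det with hδdef
  have hδmul : ∀ g h, δ (g * h) = δ g * δ h := fun g h ↦ by
    simp only [hδdef, hMmul, Matrix.det_mul]
  have hroot : ∀ g, χ g ^ 2 - τ g * χ g + δ g = 0 := fun g ↦
    sq_sub_trace_mul_add_det_eq_zero hv (hχ g).symm
  set χ₂ : G → L := fun g ↦ δ g / χ g with hχ₂def
  have hτ : ∀ g, τ g = χ g + χ₂ g := fun g ↦ by
    have h1 := hroot g
    have h2 : χ₂ g * χ g = δ g := div_mul_cancel₀ _ (hχne g)
    have h3 : χ g * (τ g - χ g - χ₂ g) = 0 := by linear_combination -h1 - h2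
    have := (mul_eq_zero.mp h3).resolve_left (hχne g)
    linear_combination this
  have hδ : ∀ g, δ g = χ g * χ₂ g := fun g ↦ by
    rw [hχ₂def]; simp only; rw [mul_div_cancel₀ _ (hχne g)]
  have hchar : ∀ g, (M g).charpoly = X ^ 2 - C (χ g + χ₂ g) * X + C (χ g * χ₂ g) := fun g ↦ by
    rw [Matrix.charpoly_fin_two, ← hτ, ← hδ]
  -- ### `τ g`, `δ g` are fixed by Frobenius
  have hτfix : ∀ g, τ g ^ q = τ g := by
    intro g
    obtain ⟨Q, hQ⟩ := hφ g
    have h1 : (Q.map j).coeff 1 = -(M g).trace := by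
      rw [hQ, show ((φ g : GL (Fin 2) L) : Matrix (Fin 2) (Fin 2) L) = M g from rfl,
        Matrix.charpoly_fin_two]
      simp [coeff_C, coeff_X_pow]
    rw [Polynomial.coeff_map] at h1
    have h2 : τ g = j (-Q.coeff 1) := by
      rw [map_neg, h1, neg_neg]
    rw [h2]; exact (hfix _).mp ⟨_, rfl⟩
  have hδfix : ∀ g, δ g ^ q = δ g := by
    intro g
    obtain ⟨Q, hQ⟩ := hφ g
    have h1 : (Q.map j).coeff 0 = (M g).det := by
      rw [hQ, show ((φ g : GL (Fin 2) L) : Matrix (Fin 2) (Fin 2) L) = M g from rfl,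
        Matrix.charpoly_fin_two]
      simp [coeff_C, coeff_X_pow]
    rw [Polynomial.coeff_map] at h1
    change (M g).det ^ q = (M g).det
    rw [← h1]; exact (hfix _).mp ⟨_, rfl⟩
  -- ### Frobenius permutes `{χ g, χ₂ g}`
  have hperm : ∀ g (y : L), y ^ 2 - τ g * y + δ g = 0 → y = χ g ∨ y = χ₂ g := by
    intro g y hy
    have h1 : (y - χ g) * (y - χ₂ g) = 0 := by
      rw [hτ, hδ] at hy; linear_combination hy
    rcases mul_eq_zero.mp h1 with h | h
    · exact Or.inl (sub_eq_zero.mp h)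
    · exact Or.inr (sub_eq_zero.mp h)
  have hfrobroot : ∀ g (y : L), y ^ 2 - τ g * y + δ g = 0 → (y ^ q) ^ 2 - τ g * y ^ q + δ g = 0 := by
    intro g y hy
    have h1 : (y ^ 2 - τ g * y + δ g) ^ q = 0 ^ q := by rw [hy]
    rw [hF, hsub, zero_pow Fintype.card_ne_zero, mul_pow, hτfix, hδfix, ← pow_mul, mul_comm 2 q,
      pow_mul] at h1
    exact h1
  have hχq : ∀ g, χ g ^ q = χ g ∨ χ g ^ q = χ₂ g := fun g ↦
    hperm g _ (hfrobroot g _ (hroot g))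
  have hroot₂ : ∀ g, χ₂ g ^ 2 - τ g * χ₂ g + δ g = 0 := fun g ↦ by
    rw [hτ, hδ]; ring
  have hχ₂q : ∀ g, χ₂ g ^ q = χ g ∨ χ₂ g ^ q = χ₂ g := fun g ↦
    hperm g _ (hfrobroot g _ (hroot₂ g))
  -- ### the unit-valued characters and the two subgroups
  let χ₁' : G →* Lˣ :=
    { toFun := fun g ↦ Units.mk0 (χ g) (hχne g)
      map_one' := Units.ext hχone
      map_mul' := fun g h ↦ Units.ext (hχmul g h) }
  have hχ₁' : ∀ g, ((χ₁' g : Lˣ) : L) = χ g := fun _ ↦ rfl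
  let δ' : G →* Lˣ := Matrix.GeneralLinearGroup.det.comp φ
  have hδ' : ∀ g, ((δ' g : Lˣ) : L) = δ g := fun _ ↦ rfl
  let χ₂' : G →* Lˣ := δ' * χ₁'⁻¹
  have hχ₂' : ∀ g, ((χ₂' g : Lˣ) : L) = χ₂ g := fun g ↦ by
    simp [χ₂', hδ', hχ₁', hχ₂def, div_eq_mul_inv]
  have hχ₂mul : ∀ g h, χ₂ (g * h) = χ₂ g * χ₂ h := fun g h ↦ by
    rw [← hχ₂', ← hχ₂', ← hχ₂', map_mul, Units.val_mul]
  let A : Subgroup G := ((χ₁' ^ q) * χ₁'⁻¹).ker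
  let B : Subgroup G := ((χ₁' ^ q) * χ₂'⁻¹).ker
  have hA : ∀ g, g ∈ A ↔ χ g ^ q = χ g := fun g ↦ by
    rw [MonoidHom.mem_ker, ← Units.val_inj]
    simp only [MonoidHom.mul_apply, MonoidHom.pow_apply, MonoidHom.inv_apply, Units.val_mul,
      Units.val_pow_eq_pow_val, Units.val_inv_eq_inv_val, hχ₁', Units.val_one]
    rw [mul_inv_eq_one₀ (hχne g)]
  have hχ₂ne : ∀ g, χ₂ g ≠ 0 := fun g ↦ by rw [← hχ₂']; exact Units.ne_zero _
  have hB : ∀ g, g ∈ B ↔ χ g ^ q = χ₂ g := fun g ↦ by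
    rw [MonoidHom.mem_ker, ← Units.val_inj]
    simp only [MonoidHom.mul_apply, MonoidHom.pow_apply, MonoidHom.inv_apply, Units.val_mul,
      Units.val_pow_eq_pow_val, Units.val_inv_eq_inv_val, hχ₁', hχ₂', Units.val_one]
    rw [mul_inv_eq_one₀ (hχ₂ne g)]
  have hAB : ∀ g, g ∈ A ∨ g ∈ B := fun g ↦ by
    rw [hA, hB]; exact hχq g
  -- kernel of `φ`: `χ g = 1`, `χ₂ g = 1`
  have hkerχ : ∀ g, φ g = 1 → χ g = 1 := by
    intro g hg
    apply smul_left_injective L hv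
    change χ g • v = (1 : L) • v
    rw [hχ, show M g = 1 by simp only [hMdef, hg, Units.val_one], Matrix.one_mulVec, one_smul]
  have hkerχ₂ : ∀ g, φ g = 1 → χ₂ g = 1 := by
    intro g hg
    rw [hχ₂def]; simp only
    rw [hkerχ g hg, div_one, hδdef]; simp only
    rw [show M g = 1 by simp only [hMdef, hg, Units.val_one], Matrix.det_one]
  obtain ⟨D, hD⟩ := exists_diagonalHom (k := k)
  by_cases hAtop : A = ⊤
  · -- ### Case `A = G`: all `χ g`, `χ₂ g` lie in `k`; `ρ = diag(χ, χ₂)`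
    have hχfix : ∀ g, χ g ^ q = χ g := fun g ↦ (hA g).mp (hAtop ▸ Subgroup.mem_top g)
    have hχ₂fix : ∀ g, χ₂ g ^ q = χ₂ g := fun g ↦ by
      have h1 : χ₂ g = τ g - χ g := by rw [hτ]; ring
      rw [h1, hsub, hτfix, hχfix]
    -- pull back to `k`
    have hc₁ : ∀ g, j (jinv (χ g)) = χ g := fun g ↦ hjinv _ (hχfix g)
    have hc₂ : ∀ g, j (jinv (χ₂ g)) = χ₂ g := fun g ↦ hjinv _ (hχ₂fix g)
    have hc₁ne : ∀ g, jinv (χ g) ≠ 0 := fun g h ↦ hχne g (by rw [← hc₁ g, h, map_zero])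
    have hc₂ne : ∀ g, jinv (χ₂ g) ≠ 0 := fun g h ↦ hχ₂ne g (by rw [← hc₂ g, h, map_zero])
    let c₁ : G →* kˣ :=
      { toFun := fun g ↦ Units.mk0 (jinv (χ g)) (hc₁ne g)
        map_one' := Units.ext (j.injective (by
          change j (jinv (χ 1)) = j 1
          rw [hc₁, hχone, map_one]))
        map_mul' := fun g h ↦ Units.ext (j.injective (by
          change j (jinv (χ (g * h))) = j (jinv (χ g) * jinv (χ h))
          rw [map_mul, hc₁, hc₁, hc₁, hχmul])) }
    let c₂ : G →* kˣ :=
      { toFun := fun g ↦ Units.mk0 (jinv (χ₂ g)) (hc₂ne g)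
        map_one' := Units.ext (j.injective (by
          change j (jinv (χ₂ 1)) = j 1
          rw [hc₂, map_one, hkerχ₂ 1 (map_one φ)]))
        map_mul' := fun g h ↦ Units.ext (j.injective (by
          change j (jinv (χ₂ (g * h))) = j (jinv (χ₂ g) * jinv (χ₂ h))
          rw [map_mul, hc₂, hc₂, hc₂, hχ₂mul])) }
    refine ⟨D.comp (c₁.prod c₂), fun g hg ↦ ?_, fun g ↦ ?_⟩
    · rw [MonoidHom.mem_ker] at hg ⊢
      have h1 : c₁ g = 1 := Units.ext (j.injective (by
        change j (jinv (χ g)) = j 1; rw [hc₁, hkerχ g hg, map_one]))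
      have h2 : c₂ g = 1 := Units.ext (j.injective (by
        change j (jinv (χ₂ g)) = j 1; rw [hc₂, hkerχ₂ g hg, map_one]))
      rw [MonoidHom.comp_apply, MonoidHom.prod_apply, h1, h2, ← Prod.one_eq_mk, map_one]
    · change ((D (c₁ g, c₂ g) : GL (Fin 2) k) : Matrix (Fin 2) (Fin 2) k).charpoly.map j = _
      rw [hD, Matrix.charpoly_fin_two, show ((φ g : GL (Fin 2) L) : Matrix (Fin 2) (Fin 2) L) =
        M g from rfl, hchar, Matrix.trace_fin_two, Matrix.det_diagonal, Fin.prod_univ_two]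
      have hc₁g : ((c₁ g : kˣ) : k) = jinv (χ g) := rfl
      have hc₂g : ((c₂ g : kˣ) : k) = jinv (χ₂ g) := rfl
      simp only [Matrix.diagonal_apply_eq, Matrix.cons_val_zero, Matrix.cons_val_one,
        Polynomial.map_add, Polynomial.map_sub, Polynomial.map_mul, Polynomial.map_pow,
        Polynomial.map_X, Polynomial.map_C, map_add, map_mul, hc₁g, hc₂g, hc₁, hc₂]
  · -- ### Case `B = G`, `A ≠ G`: `χ₂ = χ^q`, `χ` takes values in the quadratic extension
    have hBtop : B = ⊤ := (subgroup_eq_top_or_eq_top_of_union A B hAB).resolve_left hAtop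
    have hBall : ∀ g, χ g ^ q = χ₂ g := fun g ↦ (hB g).mp (hBtop ▸ Subgroup.mem_top g)
    obtain ⟨g₀, hg₀⟩ : ∃ g₀, g₀ ∉ A := by
      by_contra h; push Not at h
      exact hAtop (eq_top_iff.mpr fun g _ ↦ h g)
    rw [hA] at hg₀
    set α := χ g₀ with hαdef
    -- `χ g ^ {q²} = χ g`
    have hχqq : ∀ g, (χ g ^ q) ^ q = χ g := by
      intro g
      rw [hBall]
      rcases hχ₂q g with h | h
      · exact h
      · -- `χ₂ g` fixed, hence `χ g = τ g - χ₂ g` fixed, and `χ g ^ q = χ₂ g`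
        have h1 : χ g = τ g - χ₂ g := by rw [hτ]; ring
        have h2 : χ g ^ q = χ g := by rw [h1, hsub, hτfix, h]
        rw [← hBall, h2, h2]
    have hαqq : (α ^ q) ^ q = α := hχqq g₀
    have hαq : α ^ q ≠ α := hg₀
    -- `s = α + α^q`, `t = -(α α^q)` are fixed; `α² = s α + t`
    set s := α + α ^ q with hsdef
    set t := -(α * α ^ q) with htdef
    have hsfix : s ^ q = s := by rw [hsdef, hF, hαqq, add_comm]
    have htfix : t ^ q = t := by rw [htdef, hneg, mul_pow, hαqq, mul_comm]
    have hα2 : α ^ 2 = s * α + t := by rw [hsdef, htdef]; ring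
    -- coordinates of `χ g`
    set wf : L → L := fun x ↦ (x - x ^ q) / (α - α ^ q) with hwfdef
    set uf : L → L := fun x ↦ x - wf x * α with hufdef
    have hcoord : ∀ x : L, (x ^ q) ^ q = x →
        wf x ^ q = wf x ∧ uf x ^ q = uf x ∧ x ^ q = uf x + wf x * α ^ q := fun x hx ↦
      quadratic_coords hF hαqq hαq hx
    have hxuw : ∀ x : L, x = uf x + wf x * α := fun x ↦ by
      simp only [hufdef]; ring
    -- the multiplication matrices over `L`
    set ML : L → Matrix (Fin 2) (Fin 2) L := fun x ↦ !![uf x, wf x * t; wf x, uf x + wf x * s]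
      with hMLdef
    have hMLmul : ∀ x y : L, (x ^ q) ^ q = x → (y ^ q) ^ q = y → ML (x * y) = ML x * ML y := by
      intro x y hx hy
      obtain ⟨hwx, hux, -⟩ := hcoord x hx
      obtain ⟨hwy, huy, -⟩ := hcoord y hy
      have hxy : ((x * y) ^ q) ^ q = x * y := by rw [mul_pow, mul_pow, hx, hy]
      obtain ⟨hwxy, huxy, -⟩ := hcoord (x * y) hxy
      -- both `(uf (xy), wf (xy))` and the product coordinates are coordinates of `xy`
      have hfixU : (uf x * uf y + wf x * wf y * t) ^ q = uf x * uf y + wf x * wf y * t := by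
        rw [hF, mul_pow, mul_pow, mul_pow, hux, huy, hwx, hwy, htfix]
      have hfixW : (uf x * wf y + wf x * uf y + wf x * wf y * s) ^ q =
          uf x * wf y + wf x * uf y + wf x * wf y * s := by
        rw [hF, hF, mul_pow, mul_pow, mul_pow, mul_pow, hux, huy, hwx, hwy, hsfix]
      have heq : uf (x * y) + wf (x * y) * α =
          (uf x * uf y + wf x * wf y * t) + (uf x * wf y + wf x * uf y + wf x * wf y * s) * α := by
        rw [← hxuw (x * y)]
        conv_lhs => rw [hxuw x, hxuw y]
        linear_combination (wf x * wf y) * hα2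
      obtain ⟨hU, hW⟩ := quadratic_coords_unique hF hαq huxy hwxy hfixU hfixW heq
      simp only [hMLdef]
      rw [hU, hW]
      exact mulMatrix_mul s t (uf x) (wf x) (uf y) (wf y)
    have hMLone : ML 1 = 1 := by
      have hw1 : wf 1 = 0 := by simp only [hwfdef]; rw [one_pow, sub_self, zero_div]
      have hu1 : uf 1 = 1 := by simp only [hufdef]; rw [hw1, zero_mul, sub_zero]
      simp only [hMLdef, hw1, hu1]
      ext i j; fin_cases i <;> fin_cases j <;> simp
    have hMLchar : ∀ x : L, (x ^ q) ^ q = x →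
        (ML x).charpoly = X ^ 2 - C (x + x ^ q) * X + C (x * x ^ q) := by
      intro x hx
      obtain ⟨-, -, hxq⟩ := hcoord x hx
      rw [Matrix.charpoly_fin_two]
      simp only [hMLdef, mulMatrix_trace, mulMatrix_det]
      have h1 : x + x ^ q = 2 * uf x + wf x * s := by
        rw [hxq]; conv_lhs => rw [hxuw x]
        rw [hsdef]; ring
      have h2 : x * x ^ q = uf x ^ 2 + uf x * wf x * s - wf x ^ 2 * t := by
        rw [hxq]; conv_lhs => rw [hxuw x]
        have : α ^ q = s - α := by rw [hsdef]; ring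
        rw [this]; linear_combination (- wf x ^ 2) * hα2
      rw [h1, h2]
    -- pull back to `k`
    set Mk : L → Matrix (Fin 2) (Fin 2) k := fun x ↦
      !![jinv (uf x), jinv (wf x) * jinv t; jinv (wf x), jinv (uf x) + jinv (wf x) * jinv s]
      with hMkdef
    have hMkmap : ∀ x : L, (x ^ q) ^ q = x → (Mk x).map j = ML x := by
      intro x hx
      obtain ⟨hwx, hux, -⟩ := hcoord x hx
      simp only [hMkdef, hMLdef]
      ext i j'
      fin_cases i <;> fin_cases j' <;>
        simp [map_add, map_mul, hjinv _ hwx, hjinv _ hux, hjinv _ hsfix, hjinv _ htfix]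
    have hmapinj : Function.Injective (fun A : Matrix (Fin 2) (Fin 2) k ↦ A.map j) :=
      fun A B h ↦ Matrix.ext fun i i' ↦ j.injective (congrFun (congrFun h i) i')
    set ρ₀ : G → Matrix (Fin 2) (Fin 2) k := fun g ↦ Mk (χ g) with hρ₀def
    have hρ₀map : ∀ g, (ρ₀ g).map j = ML (χ g) := fun g ↦ hMkmap _ (hχqq g)
    have hρ₀mul : ∀ g h, ρ₀ (g * h) = ρ₀ g * ρ₀ h := by
      intro g h
      apply hmapinj
      change (ρ₀ (g * h)).map j = (ρ₀ g * ρ₀ h).map j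
      rw [Matrix.map_mul, hρ₀map, hρ₀map, hρ₀map, hχmul, hMLmul _ _ (hχqq g) (hχqq h)]
    have hρ₀one' : ∀ g, χ g = 1 → ρ₀ g = 1 := by
      intro g hg
      apply hmapinj
      change (ρ₀ g).map j = (1 : Matrix (Fin 2) (Fin 2) k).map j
      rw [hρ₀map, hg, hMLone, Matrix.map_one j (map_zero j) (map_one j)]
    have hρ₀one : ρ₀ 1 = 1 := hρ₀one' 1 hχone
    let ρ : G →* GL (Fin 2) k :=
      { toFun := fun g ↦ ⟨ρ₀ g, ρ₀ g⁻¹, by rw [← hρ₀mul, mul_inv_cancel, hρ₀one],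
          by rw [← hρ₀mul, inv_mul_cancel, hρ₀one]⟩
        map_one' := Units.ext hρ₀one
        map_mul' := fun g h ↦ Units.ext (hρ₀mul g h) }
    refine ⟨ρ, fun g hg ↦ ?_, fun g ↦ ?_⟩
    · rw [MonoidHom.mem_ker] at hg ⊢
      exact Units.ext (hρ₀one' g (hkerχ g hg))
    · change (ρ₀ g).charpoly.map j = _
      rw [← Matrix.charpoly_map, hρ₀map, hMLchar _ (hχqq g),
        show ((φ g : GL (Fin 2) L) : Matrix (Fin 2) (Fin 2) L) = M g from rfl, hchar, ← hBall]

end CommonEigenvector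

end Literature.RepresentationTheory.Semisimple
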